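import Literature.NumberTheory.Automorphic.Liu2021.LemD1AsPrintedIndexedNonVacuityLevelCarrier
import Literature.NumberTheory.Automorphic.Liu2021.LemD1AsPrintedIndexedNonVacuityNormClassExtension
import HarnessLib

/-!
# [Liu2021, App. D §D.1 Step 2] is performable at EVERY non-split place of ANY quadratic `E/F` — the places ABOVE `2` included:
# the norm-class character extended at LEVEL `4𝔭_w`; hypothesis-free non-vacuity of [Lem. D.1 (1) ∧ (3)] AS PRINTED at every place

Reproduction ∕ bookkeeping (Literature, THEOREMS ONLY: no definition, no record, no named fact, no `sorry`; nothing is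
asserted about Liu's oscillator representations or about the tree's constructed local Weil carriers).

Sequel of `LemD1AsPrintedIndexedNonVacuityNormClassExtension.lean` (a Step-2 datum at every non-split place `∤ 2` of any quadratic
`E/F`, by extension of the `ℚ/ℤ`-valued norm-class character of `F_vˣ` along `F_vˣ → E_wˣ/U_w^{(1)}`), whose «What this does NOT give»
names the dyadic places: there the principal units of `F_v` need not be norms.  THIS FILE runs the same construction at LEVEL `4`:
the units `a ∈ F_vˣ` with `v_v(a − 1) < v_v(4)` ARE squares (the tree's local square theorem `QuadraticForms.isSquare_of_valued_sub_one_lt`,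
[Omeara1963, §63:1] «Local Square Theorem», valid at every place), hence norms, and `v_w(ι_w a − 1) < v_w(4)` implies `v_v(a − 1) < v_v(4)`
(`v_w ∘ ι_w = v_v^{e(w|v)}`, tree `valued_toPlace`); so the norm-class character extends along `F_vˣ → E_wˣ/U` for the open subgroup
`U = 1 + 4𝔭_w = {x : v_w(x − 1) < v_w(4)}` of `E_wˣ` ([NeukirchANT1999, Ch. II §3], higher unit groups), with NO hypothesis on `v`.

Setting: the tree's place model of a quadratic extension `E/F` of number fields at a finite place `v` (`F_v`, `E_v = Π_{w∣v} E_w`,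
`c ⊗ 1 = conjLocal`, `ε = δ ⊗ 1`, `c δ = −δ ≠ 0`); a «Step-2 datum» is the rows' displayed binder shape (`μ : E_vˣ → ℂˣ` unitary, continuous,
«`μ(ι_v a) = 1 ↔ a ∈ Nm E_vˣ`», [Liu2021, App. D §D.1 Step 2, l. 5219]); packaged form `LemD1OfPlace.muOf … ∈ LemD1.MuSet S`.

* §1 **`isNorm_of_valued_sub_one_lt_four`** (any `v`): `v_v(a − 1) < v_v(4) ⇒ a ∈ Nm E_vˣ`.
* §2 **`exists_stepTwo_of_nonsplit`** (ANY non-split place — inert or ramified, odd or dyadic): a Step-2 datum `μ`, trivial on the units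
  `u` with `v_w(u_w − 1) < v_w(4)`.
* §3 consequences for ANY quadratic `E/F`, ANY finite place `v`, ANY hermitian non-degenerate `J`: **`nonempty_muSet`** (Step 2 is
  performable everywhere — split: the trivial datum, `…AtPlace.one_mem_muSet_of_split`); **`exists_muSet_ne`** (two Step-2 data
  everywhere, with `…LevelTwist.exists_muSet_ne_of_nonempty`); **`not_forall_lemD1_3_of_item1`** (`N ≥ 3`: (3) AS PRINTED is not a
  consequence of (1), everywhere); **`not_forall_mu_eq`** (`N ≥ 3`: the joint records (1) ∧ (3) do not force equal μ-labels, everywhere,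
  with `…LevelCarrier.not_forall_mu_eq_twist`) — the exceptional sets (`2 ∈ v`; `N` odd) of `…NormClassExtension` §3 are gone;
  `exists_muSet_and_forall_not_unramified_of_ramified` (at a ramified non-split place — dyadic or not — the index set is non-empty and
  all its elements are ramified, `…RamifiedPlace`).

What this does NOT give: the exact conductor of the datum at a dyadic place (between `U^{(1)}` and `1 + 4𝔭_w`); an explicit formula
(Hilbert symbol) for it; anything about the rows' carriers; Lem. D.1 itself.  HC_CM is NOT proved.

Cell pub-hodgecm2 (COR-CM), audit class of the END rows `hD1''` ∕ `hD3`; seat prover-pub-hodgecm2-b10.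

References: [Liu2021] Y. Liu, *Fourier–Jacobi cycles and arithmetic relative trace formula*, Camb. J. Math. 9 (2021) =
arXiv:2102.11518, App. D §D.1 Step 2 (`FJcycle.tex` l. 5219), Lemma D.1 (1), (3) (l. 5229, 5233); [Omeara1963] O. T. O'Meara,
*Introduction to Quadratic Forms* (1963), §63A, 63:1 (Local Square Theorem) and 63:13a (`(Ḟ : N_{E/F} Ė) = 2`); [NeukirchANT1999]
J. Neukirch, *Algebraic Number Theory* (1999), Ch. II §3 (higher unit groups) with Prop. (3.10), Ch. V §1 Thm. (1.3) (local
reciprocity, `F^*/N L^* ≅ G(L|F)^{ab}`); [ClozelHarrisTaylor2008] L. Clozel, M. Harris, R. Taylor, Publ. Math. IHÉS 108 (2008), Lemma 4.1.1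
(p. 116), proof («extend this character»); [CasselsFrohlichANT1967] Ch. II §10.
-/

noncomputable section

open scoped Matrix MatrixGroups
open NumberField IsDedekindDomain
open Literature.RepresentationTheory
open Literature.NumberTheory.QuadraticForms (quadraticNormSubgroup)
open Literature.NumberTheory.GaloisRepresentations (HeckeCharacter)

namespace Literature.NumberTheory.Automorphic.Liu2021.LemD1IndexedNonVacuityNormClassExtensionDyadic

open UnitaryGroup

/-! ## §1 The exponential `ℚ/ℤ → ℂˣ`; squares near `1` at ANY place; the level-`4` subgroup of `E_wˣ` -/

/-- the character `ℚ/ℤ → ℂˣ`, `q ↦ e^{2πiq}`: a homomorphism, injective, with values of norm `1` (copy of the private lemma of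
`…NormClassExtension`). [folklore] -/
private theorem exists_addCircle_character :
    ∃ e : AddCircle (1 : ℚ) → ℂˣ, e 0 = 1 ∧ (∀ x y, e (x + y) = e x * e y) ∧
      Function.Injective e ∧ ∀ x, ‖((e x : ℂˣ) : ℂ)‖ = 1 := by
  let E : ℚ →+ Additive ℂˣ :=
    { toFun := fun q => Additive.ofMul (Units.mk0 (Complex.exp (2 * Real.pi * Complex.I * (q : ℂ))) (Complex.exp_ne_zero _))
      map_zero' := by
        apply Additive.toMul.injective
        apply Units.ext
        simp
      map_add' := fun q q' => by
        apply Additive.toMul.injective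
        apply Units.ext
        simp only [toMul_ofMul, Units.val_mk0, toMul_add, Units.val_mul, Rat.cast_add, mul_add,
          Complex.exp_add] }
  have hE : ∀ q : ℚ, ((Additive.toMul (E q) : ℂˣ) : ℂ) = Complex.exp (2 * Real.pi * Complex.I * (q : ℂ)) := fun q => rfl
  have hker : AddSubgroup.zmultiples (1 : ℚ) ≤ E.ker := by
    intro q hq
    obtain ⟨n, rfl⟩ := AddSubgroup.mem_zmultiples_iff.mp hq
    rw [AddMonoidHom.mem_ker]
    apply Additive.toMul.injective
    apply Units.ext
    rw [hE]
    change Complex.exp (2 * Real.pi * Complex.I * ((n • (1 : ℚ) : ℚ) : ℂ)) = ((1 : ℂˣ) : ℂ)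
    rw [Units.val_one, zsmul_one, Rat.cast_intCast,
      show 2 * (Real.pi : ℂ) * Complex.I * (n : ℂ) = n * (2 * Real.pi * Complex.I) by ring]
    exact Complex.exp_int_mul_two_pi_mul_I n
  let ē : AddCircle (1 : ℚ) →+ Additive ℂˣ := QuotientAddGroup.lift _ E hker
  have hē : ∀ q : ℚ, ē (q : AddCircle (1 : ℚ)) = E q := fun q => QuotientAddGroup.lift_mk' _ _ q
  refine ⟨fun x => Additive.toMul (ē x), ?_, fun x y => ?_, fun x y hxy => ?_, fun x => ?_⟩
  · show Additive.toMul (ē 0) = 1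
    rw [map_zero]; rfl
  · show Additive.toMul (ē (x + y)) = Additive.toMul (ē x) * Additive.toMul (ē y)
    rw [map_add]; rfl
  · have hxy' : ē x = ē y := Additive.toMul.injective hxy
    rw [← sub_eq_zero, ← map_sub] at hxy'
    rw [← sub_eq_zero]
    induction x using QuotientAddGroup.induction_on with
    | H qx =>
    induction y using QuotientAddGroup.induction_on with
    | H qy =>
    rw [← QuotientAddGroup.mk_sub, hē] at hxy'
    rw [← QuotientAddGroup.mk_sub, QuotientAddGroup.eq_zero_iff]
    have h1 : Complex.exp (2 * Real.pi * Complex.I * ((qx - qy : ℚ) : ℂ)) = 1 := by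
      rw [← hE, hxy']; rfl
    obtain ⟨n, hn⟩ := Complex.exp_eq_one_iff.mp h1
    have hπ : (2 * Real.pi * Complex.I : ℂ) ≠ 0 := by simp [Real.pi_ne_zero, Complex.I_ne_zero]
    have h2 : ((qx - qy : ℚ) : ℂ) = (n : ℂ) :=
      mul_right_cancel₀ hπ (by rw [mul_comm]; exact hn)
    have h3 : (qx - qy : ℚ) = (n : ℚ) := by exact_mod_cast h2
    rw [h3]
    exact AddSubgroup.mem_zmultiples_iff.mpr ⟨n, by rw [zsmul_one]⟩
  · induction x using QuotientAddGroup.induction_on with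
    | H q =>
    show ‖((Additive.toMul (ē (q : AddCircle (1 : ℚ))) : ℂˣ) : ℂ)‖ = 1
    rw [hē, hE, Complex.norm_exp]
    simp

/-- `(1/2 : ℚ/ℤ)` has order `2` (copy of the private lemma of `…NormClassExtension`). [folklore] -/
private theorem half_addCircle :
    (((1 / 2 : ℚ) : AddCircle (1 : ℚ)) ≠ 0) ∧ ((1 / 2 : ℚ) : AddCircle (1 : ℚ)) + ((1 / 2 : ℚ) : AddCircle (1 : ℚ)) = 0 := by
  constructor
  · intro h
    rw [AddCircle.coe_eq_zero_iff] at h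
    obtain ⟨n, hn⟩ := h
    rw [zsmul_eq_mul, mul_one] at hn
    have h2 : (2 * n : ℤ) = 1 := by exact_mod_cast (by linear_combination 2 * hn : (2 * n : ℚ) = 1)
    omega
  · rw [← AddCircle.coe_add, show (1 / 2 + 1 / 2 : ℚ) = 1 by norm_num, AddCircle.coe_period]

/-- A homomorphism with open kernel is locally constant (copy of the tree's private lemma). [folklore] -/
private theorem isLocallyConstant_of_isOpen_ker {Γ G : Type*} [Group Γ] [TopologicalSpace Γ]
    [ContinuousMul Γ] [Group G] (r : Γ →* G) (h : IsOpen (r.ker : Set Γ)) :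
    IsLocallyConstant r := by
  refine (IsLocallyConstant.iff_exists_open r).2 fun σ => ⟨{τ | σ⁻¹ * τ ∈ r.ker}, ?_, ?_, ?_⟩
  · exact h.preimage (continuous_const_mul σ⁻¹)
  · show σ⁻¹ * σ ∈ r.ker
    rw [inv_mul_cancel]; exact r.ker.one_mem
  · intro τ hτ
    have hτ' : r (σ⁻¹ * τ) = 1 := hτ
    rw [map_mul, map_inv, inv_mul_eq_one] at hτ'
    exact hτ'.symm

section PlaceModel

variable {F : Type} (E : Type) [Field F] [NumberField F] [Field E] [NumberField E] [Algebra F E]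
  [Algebra.IsQuadraticExtension F E] (v : HeightOneSpectrum (𝓞 F)) (c : E ≃ₐ[F] E)
  {δ : E} (hcδ : c δ = -δ) (hδ : δ ≠ 0)

include hcδ hδ in
/-- `δ² ∈ F` (copy of the private lemma of `LemD1IndexedNonVacuityNonsplitPlace`). [folklore] -/
private theorem exists_delta_mul_self_eq_algebraMap : ∃ d : F, δ * δ = algebraMap F E d := by
  obtain ⟨x, y, hxy⟩ := exists_eq_add_mul_of_isQuadraticExtension (F := F) (E := E)
    (not_mem_range_algebraMap_of_apply_eq_neg E c hcδ hδ) (δ * δ)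
  have hc2 : c (δ * δ) = δ * δ := by rw [map_mul, hcδ, neg_mul_neg]
  have hy : algebraMap F E y * δ = 0 := by
    have h1 : c (δ * δ) = algebraMap F E x - algebraMap F E y * δ := by
      rw [hxy, map_add, map_mul, AlgEquiv.commutes, AlgEquiv.commutes, hcδ, mul_neg, sub_eq_add_neg]
    rw [hc2, hxy] at h1
    have h2 : (2 : E) * (algebraMap F E y * δ) = 0 := by linear_combination h1
    exact (mul_eq_zero.1 h2).resolve_left two_ne_zero
  exact ⟨x, by rw [hxy, hy, add_zero]⟩

omit [Algebra.IsQuadraticExtension F E] in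
/-- squares of `F_vˣ` are norms from `E_vˣ`: `ι_v(r) · (c ⊗ 1)(ι_v r) = ι_v(r²)`. [cite: Liu2021, App. D §D.1 Step 2 (l. 5219)] -/
private theorem isNorm_of_sq (r : (v.adicCompletion F)ˣ) :
    ∃ x : (LocalRing E v)ˣ, (x : LocalRing E v) * conjLocal E c v x =
      algebraMap (v.adicCompletion F) (LocalRing E v) ((r * r : (v.adicCompletion F)ˣ) : v.adicCompletion F) :=
  ⟨Units.map (algebraMap (v.adicCompletion F) (LocalRing E v)).toMonoidHom r, by
    rw [Units.coe_map, RingHom.toMonoidHom_eq_coe, MonoidHom.coe_coe, algebraMap_localRing_eq, conjLocal_toLocalRing,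
      Units.val_mul, map_mul]⟩

omit [Algebra.IsQuadraticExtension F E] in
/-- **the units `a` of `F_v` with `v_v(a − 1) < v_v(4)` are norms from `E_vˣ` — at EVERY place `v`, dyadic included**: such `a` are
squares (the tree's local square theorem `QuadraticForms.isSquare_of_valued_sub_one_lt`, [Omeara1963, 63:1]) and squares are norms.
At `v ∤ 2` (`v_v(4) = 1`) these are the principal units (`…NormClassExtension.isNorm_of_valued_sub_one_lt`).
[cite: Omeara1963, §63A, 63:1 (Local Square Theorem)] [cite: Liu2021, App. D §D.1 Step 2 (l. 5219)] -/
theorem isNorm_of_valued_sub_one_lt_four (a : (v.adicCompletion F)ˣ)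
    (ha : Valued.v ((a : v.adicCompletion F) - 1) < Valued.v (4 : v.adicCompletion F)) :
    ∃ x : (LocalRing E v)ˣ, (x : LocalRing E v) * conjLocal E c v x = algebraMap (v.adicCompletion F) (LocalRing E v) a := by
  have hsq : IsSquare (a : v.adicCompletion F) := QuadraticForms.isSquare_of_valued_sub_one_lt F v ha
  obtain ⟨r, hr⟩ := hsq
  have hr0 : r ≠ 0 := fun h => a.ne_zero (by rw [hr, h, mul_zero])
  obtain ⟨x, hx⟩ := isNorm_of_sq E v c (Units.mk0 r hr0)
  exact ⟨x, by rw [hx, Units.val_mul, Units.val_mk0, ← hr]⟩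

omit [NumberField F] [Algebra.IsQuadraticExtension F E] in
/-- `v_w(4) ≠ 0` and `v_w(4) ≤ 1` in `E_w` (characteristic `0`; `4 = 2 · 2`, `2 = 1 + 1`). [folklore] -/
private theorem valued_four_ne_zero_and_le_one (w : HeightOneSpectrum (𝓞 E)) :
    Valued.v (4 : w.adicCompletion E) ≠ 0 ∧ Valued.v (4 : w.adicCompletion E) ≤ 1 := by
  refine ⟨(Valuation.ne_zero_iff _).2 ?_, ?_⟩
  · have : (4 : w.adicCompletion E) = algebraMap E (w.adicCompletion E) 4 := by rw [map_ofNat]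
    rw [this]
    exact (map_ne_zero_iff _ (algebraMap E (w.adicCompletion E)).injective).2 (by norm_num)
  · have h2 : Valued.v (2 : w.adicCompletion E) ≤ 1 := by
      rw [show (2 : w.adicCompletion E) = 1 + 1 by norm_num]
      exact (Valuation.map_add _ _ _).trans (by rw [Valuation.map_one, max_self])
    rw [show (4 : w.adicCompletion E) = 2 * 2 by norm_num, Valuation.map_mul]
    exact mul_le_one' h2 h2

omit [NumberField F] [Algebra.IsQuadraticExtension F E] in
/-- **the level-`4` subgroup `1 + 4𝔭_w = {x : v_w(x − 1) < v_w(4)}` of `E_wˣ`** (an open subgroup; its members are units of valuation `1`).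
[cite: NeukirchANT1999, Ch. II §3 Prop. (3.10)] -/
private theorem exists_levelFour_subgroup (w : HeightOneSpectrum (𝓞 E)) :
    ∃ U : Subgroup (w.adicCompletion E)ˣ, ∀ x : (w.adicCompletion E)ˣ,
      x ∈ U ↔ Valued.v ((x : w.adicCompletion E) - 1) < Valued.v (4 : w.adicCompletion E) := by
  obtain ⟨hv4, hv4le⟩ := valued_four_ne_zero_and_le_one E w
  have hval : ∀ x : (w.adicCompletion E)ˣ, Valued.v ((x : w.adicCompletion E) - 1) < Valued.v (4 : w.adicCompletion E) →
      Valued.v (x : w.adicCompletion E) = 1 := fun x hx => by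
    have := Valuation.map_one_add_of_lt Valued.v (hx.trans_le hv4le)
    rwa [add_sub_cancel] at this
  refine ⟨{ carrier := {x | Valued.v ((x : w.adicCompletion E) - 1) < Valued.v (4 : w.adicCompletion E)}
            mul_mem' := fun {a b} ha hb => ?_
            one_mem' := ?_
            inv_mem' := fun {a} ha => ?_ }, fun x => Iff.rfl⟩
  · simp only [Set.mem_setOf_eq] at ha hb ⊢
    rw [Units.val_mul, show (a : w.adicCompletion E) * b - 1 = a * (b - 1) + (a - 1) by ring]
    refine (Valuation.map_add _ _ _).trans_lt (max_lt ?_ ha)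
    rw [Valuation.map_mul, hval a ha, one_mul]
    exact hb
  · simp only [Set.mem_setOf_eq, Units.val_one, sub_self, Valuation.map_zero]
    exact zero_lt_iff.2 hv4
  · simp only [Set.mem_setOf_eq] at ha ⊢
    rw [show ((a⁻¹ : (w.adicCompletion E)ˣ) : w.adicCompletion E) - 1 =
        ((a⁻¹ : (w.adicCompletion E)ˣ) : w.adicCompletion E) * (1 - a) by
          rw [mul_sub, mul_one, Units.inv_mul],
      Valuation.map_mul, Valuation.map_sub_swap, Units.val_inv_eq_inv_val, map_inv₀, hval a ha, inv_one, one_mul]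
    exact ha

omit [Algebra.IsQuadraticExtension F E] in
/-- the `w`-component of `ι_v a` is `ι_w a` (units form; copy). [cite: CasselsFrohlichANT1967, Ch. II §10] -/
private theorem units_map_eval_units_map_algebraMap (w : PlacesOver E v) (a : (v.adicCompletion F)ˣ) :
    Units.map (Pi.evalRingHom (fun w' : PlacesOver E v => w'.1.adicCompletion E) w).toMonoidHom
        (Units.map (algebraMap (v.adicCompletion F) (LocalRing E v)).toMonoidHom a) =
      Units.map (toPlace v w).toMonoidHom a :=
  Units.ext (by
    rw [Units.coe_map, Units.coe_map, Units.coe_map, RingHom.toMonoidHom_eq_coe, MonoidHom.coe_coe, RingHom.toMonoidHom_eq_coe,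
      MonoidHom.coe_coe, RingHom.toMonoidHom_eq_coe, MonoidHom.coe_coe, algebraMap_localRing_eq]
    rfl)

/-! ## §2 A Step-2 datum at EVERY non-split place of ANY quadratic `E/F` — dyadic places included -/

include hcδ hδ in
/-- **A STEP-2 DATUM AT EVERY NON-SPLIT PLACE OF ANY QUADRATIC `E/F`** (inert or ramified, of ANY residue characteristic): at a place
`w ∣ v` fixed by `c` there is `μ : E_vˣ → ℂˣ` unitary, continuous, trivial on the units `u` with `v_w(u_w − 1) < v_w(4)`, satisfying the
printed clause «`μ(ι_v a) = 1 ↔ a ∈ Nm E_vˣ`».  Construction as in `…NormClassExtension.exists_stepTwo_of_nonsplit` (the `ℚ/ℤ`-valued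
norm-class character of `F_vˣ`, of order `2` as the norm index is `2`, extended along `F_vˣ → E_wˣ/U` by divisibility of `ℚ/ℤ` and
exponentiated), with `U = 1 + 4𝔭_w` in place of `U^{(1)}_w`: the character is trivial on the `a` with `ι_w a ∈ U` because then
`v_v(a − 1) < v_v(4)` (`v_w ∘ ι_w = v_v^{e}`) and such `a` are norms (§1, local square theorem).
[cite: Liu2021, App. D §D.1 Step 2 (l. 5219)] [cite: NeukirchANT1999, Ch. V §1 Thm. (1.3)] [cite: Omeara1963, §63A, 63:1]
[cite: ClozelHarrisTaylor2008, Lemma 4.1.1 (p. 116), proof] -/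
theorem exists_stepTwo_of_nonsplit (w : PlacesOver E v) (hw : c • w.1 = w.1) :
    ∃ (μ : (LocalRing E v)ˣ →* ℂˣ) (_ : ∀ x, ‖((μ x : ℂˣ) : ℂ)‖ = 1) (_ : Continuous fun x => ((μ x : ℂˣ) : ℂ))
      (_ : ∀ a : (v.adicCompletion F)ˣ,
        μ (Units.map (algebraMap (v.adicCompletion F) (LocalRing E v)).toMonoidHom a) = 1 ↔
          ∃ x : (LocalRing E v)ˣ, (x : LocalRing E v) * conjLocal E c v x =
            algebraMap (v.adicCompletion F) (LocalRing E v) a),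
      ∀ u : (LocalRing E v)ˣ, Valued.v ((u : LocalRing E v) w - 1) < Valued.v (4 : w.1.adicCompletion E) → μ u = 1 := by
  classical
  obtain ⟨d, hd⟩ := exists_delta_mul_self_eq_algebraMap E c hcδ hδ
  have hNiff := fun a => LemD1IndexedNonVacuityNonsplitPlace.isNorm_iff_mem_quadraticNormSubgroup E v c hcδ hδ hd a
  have hidx := LemD1IndexedNonVacuityNonsplitPlace.index_norms_eq_two_of_nonsplit E v c hcδ hδ w hw hd
  set Nm := quadraticNormSubgroup (v.adicCompletion F) (d : v.adicCompletion F) with hNm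
  obtain ⟨hhalf0, hhalf2⟩ := half_addCircle
  -- the ℚ/ℤ-valued norm class character of `F_vˣ`
  let cN : (v.adicCompletion F)ˣ → AddCircle (1 : ℚ) := fun a => if a ∈ Nm then 0 else ((1 / 2 : ℚ) : AddCircle (1 : ℚ))
  have hcN_mem : ∀ a, a ∈ Nm → cN a = 0 := fun a ha => if_pos ha
  have hcN_not : ∀ a, a ∉ Nm → cN a = ((1 / 2 : ℚ) : AddCircle (1 : ℚ)) := fun a ha => if_neg ha
  have hcN_zero_iff : ∀ a, cN a = 0 ↔ a ∈ Nm := fun a =>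
    ⟨fun h => by_contra fun ha => hhalf0 (by rw [← hcN_not a ha, h]), hcN_mem a⟩
  have hcN_add : ∀ a b, cN (a * b) = cN a + cN b := by
    intro a b
    by_cases ha : a ∈ Nm <;> by_cases hb : b ∈ Nm
    · rw [hcN_mem a ha, hcN_mem b hb, hcN_mem _ (Nm.mul_mem ha hb), add_zero]
    · have hab : a * b ∉ Nm := fun h => hb (by simpa using Nm.mul_mem (Nm.inv_mem ha) h)
      rw [hcN_mem a ha, hcN_not b hb, hcN_not _ hab, zero_add]
    · have hab : a * b ∉ Nm := fun h => ha (by simpa using Nm.mul_mem h (Nm.inv_mem hb))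
      rw [hcN_not a ha, hcN_mem b hb, hcN_not _ hab, add_zero]
    · have hab : a * b ∈ Nm := (Subgroup.mul_mem_iff_of_index_two hidx).2 (iff_of_false ha hb)
      rw [hcN_not a ha, hcN_not b hb, hcN_mem _ hab, hhalf2]
  -- `F_vˣ → E_wˣ / (1 + 4𝔭_w)`
  obtain ⟨U, hU⟩ := exists_levelFour_subgroup E w.1
  let ιw : (v.adicCompletion F)ˣ →* (w.1.adicCompletion E)ˣ := Units.map (toPlace v w).toMonoidHom
  let g : (v.adicCompletion F)ˣ →* (w.1.adicCompletion E)ˣ ⧸ U := (QuotientGroup.mk' U).comp ιw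
  have h4 : (4 : w.1.adicCompletion E) = toPlace v w 4 := by rw [map_ofNat]
  have hker : ∀ a, g a = 1 → cN a = 0 := by
    intro a ha
    have ha' : ιw a ∈ U := by
      rw [MonoidHom.comp_apply, QuotientGroup.mk'_apply, QuotientGroup.eq_one_iff] at ha
      exact ha
    rw [hU] at ha'
    have hv : Valued.v ((a : v.adicCompletion F) - 1) < Valued.v (4 : v.adicCompletion F) := by
      have h1 : ((ιw a : (w.1.adicCompletion E)ˣ) : w.1.adicCompletion E) - 1 = toPlace v w ((a : v.adicCompletion F) - 1) := by
        rw [map_sub, map_one]; rfl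
      rw [h1, h4, valued_toPlace, valued_toPlace] at ha'
      by_contra hge
      exact absurd ha' (not_lt.2 (pow_le_pow_left' (not_lt.1 hge) _))
    exact hcN_mem a ((hNiff a).1 (isNorm_of_valued_sub_one_lt_four E v c a hv))
  obtain ⟨φ, hφadd, hφg⟩ :=
    GaloisRepresentations.ClozelHarrisTaylor2008.exists_character_comp_eq (Q := (w.1.adicCompletion E)ˣ ⧸ U) g cN hcN_add hker
  have hφadd' : ∀ x y : (w.1.adicCompletion E)ˣ ⧸ U, φ (x * y) = φ x + φ y := hφadd
  have hφ0 : φ 1 = 0 := by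
    have h := hφg 1
    rwa [map_one, hcN_mem 1 Nm.one_mem] at h
  obtain ⟨e, he0, headd, heinj, henorm⟩ := exists_addCircle_character
  -- the character of `E_wˣ` and of `E_vˣ`
  let μw : (w.1.adicCompletion E)ˣ →* ℂˣ :=
    { toFun := fun x => e (φ (x : (w.1.adicCompletion E)ˣ ⧸ U))
      map_one' := by rw [QuotientGroup.mk_one, hφ0, he0]
      map_mul' := fun x y => by rw [QuotientGroup.mk_mul, hφadd', headd] }
  have hμw : ∀ x, μw x = e (φ (x : (w.1.adicCompletion E)ˣ ⧸ U)) := fun x => rfl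
  have hμwU : ∀ x, x ∈ U → μw x = 1 := fun x hx => by
    rw [hμw, (QuotientGroup.eq_one_iff x).2 hx, hφ0, he0]
  let prw : (LocalRing E v)ˣ →* (w.1.adicCompletion E)ˣ :=
    Units.map (Pi.evalRingHom (fun w' : PlacesOver E v => w'.1.adicCompletion E) w).toMonoidHom
  have hprw : ∀ y : (LocalRing E v)ˣ, ((prw y : (w.1.adicCompletion E)ˣ) : w.1.adicCompletion E) = (y : LocalRing E v) w :=
    fun y => rfl
  have hlevel : ∀ u : (LocalRing E v)ˣ, Valued.v ((u : LocalRing E v) w - 1) < Valued.v (4 : w.1.adicCompletion E) →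
      (μw.comp prw) u = 1 := fun u hu => by
    rw [MonoidHom.comp_apply]
    exact hμwU _ ((hU _).2 (by rw [hprw]; exact hu))
  refine ⟨μw.comp prw, fun x => henorm _, ?_, fun a => ?_, hlevel⟩
  · -- continuity: open kernel
    have hopen : IsOpen ((μw.comp prw).ker : Set (LocalRing E v)ˣ) := by
      refine Subgroup.isOpen_of_mem_nhds _ (g := 1) ?_
      have hO : IsOpen {y : w.1.adicCompletion E | Valued.v (y - 1) < Valued.v (4 : w.1.adicCompletion E)} := by
        have h := (Valued.isOpen_ball (w.1.adicCompletion E) (Valued.v.restrict (4 : w.1.adicCompletion E))).preimage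
          (show Continuous fun y : w.1.adicCompletion E => y - 1 from continuous_id.sub continuous_const)
        convert h using 1
        ext y
        simp only [Set.mem_setOf_eq, Set.mem_preimage, Valuation.restrict_lt_iff]
      have h1 : {y : w.1.adicCompletion E | Valued.v (y - 1) < Valued.v (4 : w.1.adicCompletion E)} ∈
          nhds (((1 : (LocalRing E v)ˣ) : LocalRing E v) w) := by
        refine hO.mem_nhds ?_
        rw [Units.val_one, Pi.one_apply, Set.mem_setOf_eq, sub_self, Valuation.map_zero]
        exact zero_lt_iff.2 (valued_four_ne_zero_and_le_one E w.1).1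
      have h2' := ((continuous_apply w).comp Units.continuous_val).continuousAt.preimage_mem_nhds h1
      exact Filter.mem_of_superset h2' fun x hx => hlevel x hx
    exact Units.continuous_val.comp (isLocallyConstant_of_isOpen_ker _ hopen).continuous
  · -- the printed clause
    rw [MonoidHom.comp_apply, units_map_eval_units_map_algebraMap E v w a, hμw]
    change e (φ (g a)) = 1 ↔ _
    rw [hφg, ← he0, heinj.eq_iff, hcN_zero_iff]
    exact (hNiff a).symm

/-! ## §3 Consequences: Step 2 performable at EVERY place of ANY quadratic `E/F`; two data; the teeth and the joint records everywhere -/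

variable (N : ℕ) (J : Matrix (Fin N) (Fin N) E) (hN : 2 ≤ N) (hJh : (J.map c)ᵀ = J) (hJdet : J.det ≠ 0)

include hcδ in
/-- **`MuSet` is NON-EMPTY at every non-split place of ANY quadratic `E/F`** — ANY residue characteristic —, with an element trivial on the
units `u` with `v_w(u_w − 1) < v_w(4)`, packaged by `LemD1OfPlace.muOf`. [cite: Liu2021, App. D §D.1 Step 2 (l. 5219)] -/
theorem exists_muSet_level_of_nonsplit (w : PlacesOver E v) (hw : c • w.1 = w.1) :
    ∃ μ : LemD1.MuSet (LemD1OfPlace.standingData E v c N J hcδ hδ hN hJh hJdet),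
      ∀ u : (LocalRing E v)ˣ, Valued.v ((u : LocalRing E v) w - 1) < Valued.v (4 : w.1.adicCompletion E) → μ.1 u = 1 := by
  obtain ⟨μ, hμn, hμc, hμF, hlevel⟩ := exists_stepTwo_of_nonsplit E v c hcδ hδ w hw
  exact ⟨LemD1OfPlace.muOf E v c N J hcδ hδ hN hJh hJdet μ hμn hμc hμF, hlevel⟩

include hcδ in
/-- **`MuSet` is NON-EMPTY at EVERY finite place `v` of ANY quadratic extension `E/F` of number fields** (split: the trivial character,
`LemD1IndexedNonVacuityAtPlace.one_mem_muSet_of_split`; non-split: §2): Step 2 of [Liu2021, App. D §D.1] is performable in the place model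
EVERYWHERE without any global input — `…NormClassExtension.nonempty_muSet_of_not_two_mem` with its hypothesis `2 ∉ v` removed.
[cite: Liu2021, App. D §D.1 Step 2 (l. 5219)] -/
theorem nonempty_muSet : Nonempty (LemD1.MuSet (LemD1OfPlace.standingData E v c N J hcδ hδ hN hJh hJdet)) := by
  obtain ⟨w⟩ := (inferInstance : Nonempty (PlacesOver E v))
  by_cases hw : c • w.1 = w.1
  · obtain ⟨μ, -⟩ := exists_muSet_level_of_nonsplit E v c hcδ hδ N J hN hJh hJdet w hw
    exact ⟨μ⟩
  · obtain ⟨h1, h2', h3⟩ := LemD1IndexedNonVacuityAtPlace.one_mem_muSet_of_split E v c w hw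
    exact ⟨LemD1OfPlace.muOf E v c N J hcδ hδ hN hJh hJdet 1 h1 h2' h3⟩

include hcδ in
/-- **two DIFFERENT Step-2 data at EVERY finite place of ANY quadratic `E/F`** (§2 with the level twist `…LevelTwist.exists_muSet_ne_of_nonempty`).
[cite: Liu2021, App. D §D.1 Step 2 (l. 5219)] -/
theorem exists_muSet_ne :
    ∃ μ₁ μ₂ : LemD1.MuSet (LemD1OfPlace.standingData E v c N J hcδ hδ hN hJh hJdet), μ₁ ≠ μ₂ :=
  LemD1IndexedNonVacuityLevelTwist.exists_muSet_ne_of_nonempty E v c hcδ hδ N J hN hJh hJdet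
    (nonempty_muSet E v c hcδ hδ N J hN hJh hJdet)

include hcδ in
/-- **at a RAMIFIED non-split place — dyadic or not — the printed Step-2 index set is non-empty and ALL its elements are ramified**
(`LemD1IndexedNonVacuityRamifiedPlace.not_unramified_muSet_of_ramified`); `…NormClassExtension.exists_muSet_and_forall_not_unramified_of_ramified`
without `2 ∉ v`. [cite: Liu2021, App. D §D.1 Step 2 (l. 5219)] [cite: NeukirchANT1999, Ch. V §1 Cor. (1.2)] -/
theorem exists_muSet_and_forall_not_unramified_of_ramified (w : PlacesOver E v) (hw : c • w.1 = w.1)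
    (he : v.asIdeal.ramificationIdx' w.1.asIdeal ≠ 1) :
    Nonempty (LemD1.MuSet (LemD1OfPlace.standingData E v c N J hcδ hδ hN hJh hJdet)) ∧
      ∀ μ : LemD1.MuSet (LemD1OfPlace.standingData E v c N J hcδ hδ hN hJh hJdet),
        ¬ ∀ u : (LocalRing E v)ˣ, Valued.v ((u : LocalRing E v) w) = 1 → μ.1 u = 1 := by
  obtain ⟨μ, -⟩ := exists_muSet_level_of_nonsplit E v c hcδ hδ N J hN hJh hJdet w hw
  exact ⟨⟨μ⟩, fun μ' => LemD1IndexedNonVacuityRamifiedPlace.not_unramified_muSet_of_ramified E v c hcδ hδ N J hN hJh hJdet w hw he μ'⟩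

include hcδ in
/-- **at EVERY finite place of ANY quadratic `E/F`, [Lem. D.1 (3)] AS PRINTED is not a consequence of (1)** on two-member collections over
the place model (rank `N ≥ 3`): HYPOTHESIS-FREE form of `…NormClassExtension.not_forall_lemD1_3_of_item1_of_not_two_mem`.
[cite: Liu2021, App. D Lemma D.1 (1) and (3) (l. 5229, 5233)] -/
theorem not_forall_lemD1_3_of_item1 (h3 : 3 ≤ N) :
    ¬ ∀ Lf : LemD1IndexedFamily (v.adicCompletion F) (LocalRing E v) N (Fin 2),
        Lf.S = LemD1OfPlace.standingData E v c N J hcδ hδ hN hJh hJdet → Lf.Item1AsPrinted → LemD1_3AsPrintedI Lf :=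
  LemD1IndexedNonVacuityLevelTwist.not_forall_lemD1_3_of_item1_twist E v c hcδ hδ N J hN hJh hJdet h3
    (nonempty_muSet E v c hcδ hδ N J hN hJh hJdet)

include hcδ in
/-- **at EVERY finite place of ANY quadratic `E/F` and for EVERY `N ≥ 3`, the joint records (1) ∧ (3) do not force «all members carry
the same `μ`»** — HYPOTHESIS-FREE form of `…NormClassExtension.not_forall_mu_eq_of_not_two_mem` (which needed `2 ∉ v` and `N` odd), via
the level carrier on a reflection (`…LevelCarrier`). [cite: Liu2021, App. D Lemma D.1 (1) and (3) (l. 5229, 5233)] -/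
theorem not_forall_mu_eq (h3 : 3 ≤ N) :
    ¬ ∀ Lf : LemD1IndexedFamily (v.adicCompletion F) (LocalRing E v) N (Fin 2),
        Lf.S = LemD1OfPlace.standingData E v c N J hcδ hδ hN hJh hJdet →
        Lf.Item1AsPrinted → LemD1_3AsPrintedI Lf → ∀ i j : Fin 2, Lf.mu i = Lf.mu j :=
  LemD1IndexedNonVacuityLevelCarrier.not_forall_mu_eq_twist E v c hcδ hδ N J hN hJh hJdet h3
    (nonempty_muSet E v c hcδ hδ N J hN hJh hJdet)

end PlaceModel

end Literature.NumberTheory.Automorphic.Liu2021.LemD1IndexedNonVacuityNormClassExtensionDyadic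

end
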